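import Literature.NumberTheory.Weil1964.AdelicDoublingDiagonalLift
import Literature.NumberTheory.Weil1964.AdelicMetaplecticReindex
import Literature.NumberTheory.Weil1964.AdelicSchrodingerConj
import Literature.NumberTheory.Automorphic.AdelicSchwartzBruhatDirectSum
import Literature.NumberTheory.GelbartRogawski1991.UnitaryDualPairThetaKernel
import HarnessLib

/-!
# The DOUBLED unitary dual pair `(U(J_V), U(J_W ⊕ᶠ −J_W))` at rank one: carriers of the see-saw ∕ Siegel–Weil computation of
# [Li1992, §3 pp. 181–184] in the `X ⊕ X` frame (frame (B)) — definitions with bodies, generic in `(F, E, c, T_V, T_W)`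

J.-S. Li, *Non-vanishing theorems for the cohomology of certain arithmetic quotients*, J. reine angew. Math. **428** (1992) 177–217
[Li1992], §3: the inner product of two theta kernels over the compact `[U(J_V)]` is the theta integral of the DOUBLED pair
`(U(J_V), U(W ⊕ W⁻))` at a pure tensor `Φ₁ ⊠ Φ̄₂`; Siegel–Weil in Weil's convergent range turns it into the Eisenstein series
`E(Ψ) = Σ_{P(F)\\H(F)} (r(γ)Ψ)(0)` [Weil1965, n° 39 (30)], which unfolds over the single rational orbit with section value
`F_φ(i(h,1)) = ⟨ω(h)φ₁, φ₂⟩` [Li1992, (13), (25)].  Topic `NumberTheory/Li1992`; namespace `Literature.NumberTheory.Li1992.DoubledPair`.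
KERNEL MATHEMATICS ONLY: definitions with bodies + kernel-checked lemmas; no `def … : Prop` letter, no `axiom`, no proof hole.

PROVENANCE.  These are §1 ∕ §1b ∕ §3 of the E-2 child line `Summits/…/Cruxes/H413/Lines/F0_E2SiegelWeilWeilRange.lean` (cell
`hodgecm-mathlib`, crux H413, typed by A-p17; ED. ≤ 8 carried them in-file) moved to `Literature/` VERBATIM (same binder lists, same bodies)
so that the line's stub closers and the Siegel–Weil producers (`Theorems/H413E2SW*`) can state their letters BY NAME instead of δ-unfolding
`ratDoubledW ∕ stabDiagRat ∕ eisSection` (≈ 9 000 characters per occurrence, cf. ★ `Theorems/H413E2SWEisensteinUnfold.eis_unfold`), and so that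
the line's composition ports to a `Theorems/` file by import.  All ingredients are ★: the doubled Gram matrix `𝕋 := doubledGramFin F (adelicGram F e T_V T_W)`
(`= (T ⊗ 1) ⊕ (−T ⊗ 1)`), `Mp□ := adelicMpCont F (Fin (n+n)) 𝕋`, `ω□ := adelicMpCont.omega`, Weil's rational section `r_F^□ := ratThetaLiftCont F 𝕋 _`,
Li's `δ := doublingDeltaRat F` with `r_F(δ) = doublingDeltaLift` [Li1992, p. 181], the plain `V`-diagonal doubling lift `doublingLift ∘ ι_V`
[Weil1964, Chap. III n° 41], the pair embedding `toSp` of [GelbartRogawski1991, §3.1].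

* §1 `isUnit_det_dGram`, **`ev0`** (`Ψ ↦ (ω□(r_F δ)Ψ)(0)`, the Siegel–Weil section at the identity read through `δ`), **`boxConj`**
  (`Φ₁ ⊠ Φ̄₂`), **`actRat`** (`r_F^□`-action of `Sp_{2(n+n)}(F)`), **`siegelRat`** (`P_𝕐(F)`), **`stabDiagRat`** (`PW = δ⁻¹P_𝕐(F)δ`), **`TWD`**
  (`T_W ⊕ −T_W`), `TWD_isSymm`, **`eD`** (the doubled enumeration), **`adelicGram_eD_eq_doubledGramFin`** (the two `Sp(𝕎□_𝔸)` coincide — kernel-checked),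
  **`ratWToAut`**, **`ratSpAut`**, **`ratDoubledW`** (`IW = 1_V ⊗ U(J_W ⊕ᶠ −J_W)(F)` inside Mathlib's `Sp_{2(n+n)}(F)`), **`vDiagLift`** (`IV□`),
  **`doubledThetaIntegral`** (`I□(Ψ) = ∫_{[U(J_V)]} Θ(ω□(IV□ ξ̃⁻¹)Ψ) dν`);
* §2 the PROPERTY **`SiegelEisensteinCarrier R S act P ev0`** (`ev0 (act p Ψ) = ev0 Ψ` for `p ∈ P`, [Weil1965, n° 39 (30)] `f_Φ(pg) = f_Φ(g)`),
  the section **`eisSection act H P ev0 Ψ q := ev0 (act q.out⁻¹ Ψ)`** on `H ⧸ (P ⊓ H)` and the Eisenstein series **`eis := Σ' eisSection`**;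
* §3 `actRat_mul`, `actRat_one`, `actRat_inv_actRat`.
Honest label: HC_CM is proved only modulo the printed citations until rung 0 closes; nothing here is about HC.

## References
* [Li1992] J.-S. Li, J. reine angew. Math. 428 (1992) 177–217 — p. 181, (13) p. 181–182, (24)–(25) p. 184.
* [Weil1965] A. Weil, Acta Math. 113 (1965) 1–87 — n° 39 (30), Thm. 5 (p. 76).
* [Weil1964] A. Weil, Acta Math. 111 (1964) 143–211 — Chap. I n° 13, Chap. III n° 37–41.
* [GelbartPiatetskishapiroRallis1987] S. Gelbart, I. Piatetski-Shapiro, S. Rallis, LNM 1254 (1987), Part A §2 pp. 7–9.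
* [HarrisKudlaSweet1996] M. Harris, S. Kudla, W. J. Sweet, J. AMS 9 (1996) 941–1004, §1 (1.11)–(1.13).
-/

set_option autoImplicit false

noncomputable section

-- Mathlib's measure ∕ quotient APIs are stated across semireducible wrappers (as in the E-2 lines).
set_option backward.isDefEq.respectTransparency false

namespace Literature.NumberTheory.Li1992.DoubledPair

open scoped Matrix ComplexConjugate ENNReal
open _root_.MeasureTheory NumberField
open Literature.RepresentationTheory.HeisenbergGroup
open Literature.NumberTheory.Weil1964 Literature.NumberTheory.Automorphic
open Literature.NumberTheory.GelbartRogawski1991 Literature.NumberTheory.GelbartRogawski1991.UnitaryDualPair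

/-! ## §1 The doubled carriers (all ★, generic, at `𝕋 = doubledGramFin F (adelicGram F e T_V T_W)`) and the definitions with bodies -/

section Carriers

variable (F E : Type) [Field F] [NumberField F] [Field E] [NumberField E] [Algebra F E] [Algebra.IsQuadraticExtension F E]
  (c : E ≃ₐ[F] E) {δ : E} (hcδ : c δ = -δ) (hδ : δ ≠ 0) {d : F} (hd : δ * δ = algebraMap F E d)
  (N : ℕ) {n : ℕ} (e : Fin N × Fin 1 ≃ Fin n)
  (TV : Matrix (Fin N) (Fin N) F) (hV : TV.IsSymm) (hVd : IsUnit TV.det)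
  (TW : Matrix (Fin 1) (Fin 1) F) (hW : TW.IsSymm) (hWd : IsUnit TW.det)

include hVd hWd in
/-- `det 𝕋` is a unit (★ `isUnit_det_doubledGramFin`, ★ `isUnit_det_adelicGram`). [cite: GelbartPiatetskishapiroRallis1987, Part A §2 pp. 7–9] -/
theorem isUnit_det_dGram : IsUnit (doubledGramFin F (adelicGram F e TV TW)).det :=
  isUnit_det_doubledGramFin F _ (isUnit_det_adelicGram F e hVd hWd)

/-- **`ev₀(Ψ) := (ω□(r_F δ) Ψ)(0)`** — the Siegel–Weil section of the DIAGONAL Siegel parabolic evaluated at the identity, read in the `X ⊕ X` frame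
through Li's rational `δ` (★ `doublingDeltaLift = r_F(δ)`): the functional of ★ `AdelicDoublingDeltaOriginValue` ([Li1992, (13)]:
`ν(D^n)·ev₀(φ₁ ⊠ φ̄₂) = ⟨φ₁, φ₂⟩`).  [cite: Li1992, p. 181 and (13) p. 182] [cite: Weil1965, n° 39 (30) p. 55] -/
def ev0 (Ψ : piSchwartzBruhat F (Fin (n + n))) : ℂ :=
  ((adelicMpCont.omega F (Fin (n + n)) (doubledGramFin F (adelicGram F e TV TW))
      (doublingDeltaLift F (adelicGram F e TV TW) (isUnit_det_adelicGram F e hVd hWd)) Ψ : piSchwartzBruhat F (Fin (n + n))) :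
    (Fin (n + n) → AdeleRing (𝓞 F) F) → ℂ) 0

/-- **`Φ₁ ⊠ Φ̄₂ ∈ 𝒮(𝔸_F^{n+n})`** — the pure tensor of `Φ₁` and the COMPLEX CONJUGATE of `Φ₂` (★ `piSchwartzBruhatConj`: `ω_{−T} ≅ ω̄_T`,
[Li1992, p. 181]), read on `Fin (n + n)` through `finSumFinEquiv` (★ `piSBReindex`; = p07's `sumTensor finSumFinEquiv.symm Φ₁ (conj Φ₂)` by `rfl`).
[cite: Li1992, (13) p. 181–182] -/
def boxConj (Φ₁ Φ₂ : piSchwartzBruhat F (Fin n)) : piSchwartzBruhat F (Fin (n + n)) :=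
  piSBReindex F finSumFinEquiv (tensorToSum F (Fin n) (Fin n) Φ₁ (piSchwartzBruhatConj F (Fin n) Φ₂))

/-- the action of a RATIONAL doubled symplectic matrix `γ ∈ Sp_{2(n+n)}(F)` on `𝒮(𝔸_F^{n+n})` through Weil's `Θ`-rigid section
`r_F^□ = ratThetaLiftCont F 𝕋 _`. [cite: Weil1964, Chap. III n° 40 p. 190 and n° 41 Thm 6 p. 193] -/
def actRat (γ : Matrix.symplecticGroup (Fin (n + n)) F) (Ψ : piSchwartzBruhat F (Fin (n + n))) :
    piSchwartzBruhat F (Fin (n + n)) :=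
  adelicMpCont.omega F (Fin (n + n)) (doubledGramFin F (adelicGram F e TV TW))
    (ratThetaLiftCont F (doubledGramFin F (adelicGram F e TV TW)) (isUnit_det_dGram F N e TV hVd TW hWd) γ) Ψ

/-- **`P_𝕐(F)`** — the RATIONAL points of the standard Siegel parabolic of the doubled space (★ `siegelParabolicPi` pulled back along ★ `ratSp`).
[cite: Weil1964, Chap. I n° 13 p. 160] [cite: GelbartPiatetskishapiroRallis1987, Part A §2 pp. 7–9] -/
def siegelRat : Subgroup (Matrix.symplecticGroup (Fin (n + n)) F) :=
  (siegelParabolicPi (doubledGramFin F (adelicGram F e TV TW))).comap (ratSp F (doubledGramFin F (adelicGram F e TV TW)) (isUnit_det_dGram F N e TV hVd TW hWd))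

/-- **`PW = Stab(V ⊗ W^Δ)(F) = δ⁻¹ P_𝕐(F) δ`** — the rational stabiliser of the diagonal Lagrangian, written through Li's `δ` (which carries the diagonal
onto `𝕐`: ★ `doublingDelta_apply_diag`, ★ `stabDiagParabolic` «`δ·Stab(W^Δ)·δ⁻¹ ≤ P_𝕐`»): `γ ∈ PW ↔ δγδ⁻¹ ∈ P_𝕐(F)` (`Subgroup.mem_comap`).
[cite: Li1992, p. 181] [cite: GelbartPiatetskishapiroRallis1987, Part A §2 pp. 7–9] -/
def stabDiagRat : Subgroup (Matrix.symplecticGroup (Fin (n + n)) F) :=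
  (siegelRat F N e TV hVd TW hWd).comap (MulAut.conj (doublingDeltaRat F (n := n))).toMonoidHom

/-- the doubled line `T_W ⊕ (−T_W) ∈ M_{1+1}(F)` (Gram matrix of `W ⊕ W⁻`). [cite: GelbartPiatetskishapiroRallis1987, Part A §2 pp. 7–9] -/
def TWD : Matrix (Fin (1 + 1)) (Fin (1 + 1)) F :=
  Matrix.reindex finSumFinEquiv finSumFinEquiv (Matrix.fromBlocks TW 0 0 (-TW))

omit [NumberField F] in
include hW in
/-- `T_W ⊕ (−T_W)` is symmetric. [cite: GelbartPiatetskishapiroRallis1987, Part A §2 pp. 7–9] -/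
theorem TWD_isSymm : (TWD F TW).IsSymm := by
  unfold TWD
  rw [Matrix.IsSymm, Matrix.reindex_apply, Matrix.transpose_submatrix, Matrix.fromBlocks_transpose, Matrix.transpose_neg, hW.eq]
  simp

/-- the doubled enumeration `Fin N × Fin (1+1) ≃ Fin (n+n)`: `(i, 0) ↦ inl (e (i,0))`, `(i, 1) ↦ inr (e (i,0))` (then `finSumFinEquiv`) — so that
`V ⊗ (W ⊕ W⁻) = (V ⊗ W) ⊕ (V ⊗ W)⁻` is read in the enumeration of `𝕋`. [cite: GelbartPiatetskishapiroRallis1987, Part A §2 pp. 7–9] -/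
def eD : Fin N × Fin (1 + 1) ≃ Fin (n + n) :=
  ((Equiv.prodCongr (Equiv.refl (Fin N)) finSumFinEquiv.symm).trans (Equiv.prodSumDistrib (Fin N) (Fin 1) (Fin 1))).trans
    ((Equiv.sumCongr e e).trans finSumFinEquiv)

/-- **`adelicGram (eD) T_V (T_W ⊕ −T_W) = 𝕋`**: in the doubled enumeration `eD` the adelic Gram matrix of the DOUBLED PAIR `(U(J_V), U(J_W ⊕ᶠ −J_W))`
IS the doubled Gram matrix `(T ⊗ 1) ⊕ (−T ⊗ 1)` of the `Weil1964` doubling files — so the two symplectic groups `Sp(𝕎□_𝔸)` are the SAME subgroup of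
`Aut(𝕎□_𝔸)` and `ratDoubledW` below is the honest `1_V ⊗ U(W ⊕ W⁻)(F)` (kernel-checked, de-risking SW3). [cite: GelbartPiatetskishapiroRallis1987, Part A §2 pp. 7–9] -/
theorem adelicGram_eD_eq_doubledGramFin : adelicGram F (eD N e) TV (TWD F TW) = doubledGramFin F (adelicGram F e TV TW) := by
  rw [adelicGram_eq_map, adelicGram_eq_map, doubledGramFin_eq]
  unfold TWD
  ext i j
  obtain ⟨x, rfl⟩ := finSumFinEquiv.surjective i
  obtain ⟨y, rfl⟩ := finSumFinEquiv.surjective j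
  rcases x with i' | i' <;> rcases y with j' | j' <;>
    obtain ⟨⟨a, b⟩, rfl⟩ := e.surjective i' <;> obtain ⟨⟨a', b'⟩, rfl⟩ := e.surjective j' <;>
    simp [eD, Matrix.kroneckerMap_apply, -finSumFinEquiv_apply_right, -finSumFinEquiv_apply_left]

/-- the rational points of the doubled pair's `W`-member, `w ↦ ι(1 ⊗ w) ∈ Sp(𝕎□_𝔸)`, as linear automorphisms of `𝕎□_𝔸 = 𝔸_F^{n+n} × 𝔸_F^{n+n}`
(★ `toSp` of the DOUBLED PAIR `(U(J_V), U(T_W ⊕ −T_W))` at the enumeration `eD`, ★ `adelicInr`, ★ `toAdelic`).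
[cite: GelbartPiatetskishapiroRallis1987, Part A §2 pp. 7–9] [cite: HarrisKudlaSweet1996, §1 (1.11)–(1.13)] -/
def ratWToAut : UnitaryGroup.rational F E c (1 + 1) ((TWD F TW).map (algebraMap F E)) →*
    (((Fin (n + n) → AdeleRing (𝓞 F) F) × (Fin (n + n) → AdeleRing (𝓞 F) F)) ≃ₗ[AdeleRing (𝓞 F) F]
      ((Fin (n + n) → AdeleRing (𝓞 F) F) × (Fin (n + n) → AdeleRing (𝓞 F) F))) :=
  (symplecticGroup (polar (adelicForm F (Fin (n + n)) (adelicGram F (eD N e) TV (TWD F TW))))).subtype.comp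
    ((toSp F E c N (1 + 1) (eD N e) (TV.map (algebraMap F E)) ((TWD F TW).map (algebraMap F E)) hcδ hδ hd hV
        (TWD_isSymm F TW hW) rfl rfl).comp
      ((UnitaryGroup.adelicInr F E c N (1 + 1) (TV.map (algebraMap F E)) ((TWD F TW).map (algebraMap F E))).comp
        (UnitaryGroup.toAdelic F E c (1 + 1) ((TWD F TW).map (algebraMap F E)))))

/-- a rational doubled symplectic matrix as a linear automorphism of `𝕎□_𝔸` (★ `ratSp` at `𝕋`). [cite: Weil1964, Chap. III n° 37 p. 188] -/
def ratSpAut : Matrix.symplecticGroup (Fin (n + n)) F →*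
    (((Fin (n + n) → AdeleRing (𝓞 F) F) × (Fin (n + n) → AdeleRing (𝓞 F) F)) ≃ₗ[AdeleRing (𝓞 F) F]
      ((Fin (n + n) → AdeleRing (𝓞 F) F) × (Fin (n + n) → AdeleRing (𝓞 F) F))) :=
  (symplecticGroup (polar (adelicForm F (Fin (n + n)) (doubledGramFin F (adelicGram F e TV TW))))).subtype.comp
    (ratSp F (doubledGramFin F (adelicGram F e TV TW)) (isUnit_det_dGram F N e TV hVd TW hWd))

/-- **`IW` — the rational points of the doubled pair's `W`-member `1_V ⊗ U(J_W ⊕ᶠ −J_W)(F)`** as a subgroup of Mathlib's `Sp_{2(n+n)}(F)`: `γ ∈ IW` iff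
`ratSp γ ∈ Sp(𝕎□_𝔸)` is `ι(1 ⊗ w)` for a rational `w ∈ U(J_W ⊕ᶠ −J_W)(F)` — compared as linear automorphisms of `𝕎□_𝔸` (the two symplectic groups coincide:
`adelicGram_eD_eq_doubledGramFin`).  Frame (B): NO `δ`-conjugation. [cite: GelbartPiatetskishapiroRallis1987, Part A §2 pp. 7–9] [cite: HarrisKudlaSweet1996, §1 (1.11)–(1.13)] -/
def ratDoubledW : Subgroup (Matrix.symplecticGroup (Fin (n + n)) F) :=
  ((ratWToAut F E c hcδ hδ hd N e TV hV TW hW).range).comap (ratSpAut F N e TV hVd TW hWd)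

/-- **`IV□` — the PLAIN `V`-diagonal doubling lift** `ξ ↦ S̃(ι_V ξ) ∈ Mp□`: the pair embedding `ι_V(ξ) = ι(ξ ⊗ 1) ∈ Sp(𝕎_𝔸)` (★ `toSp ∘ adelicInl`) followed
by the ★ canonical homomorphic lift `doublingLift` of `g ↦ g^Δ = (g, g) ∈ Stab(W^Δ)(𝔸)` («`S̃(g) = r_F(δ)⁻¹ · 𝐫₀(δ g^Δ δ⁻¹) · r_F(δ)`», CHARACTER-FREE;
`= r_F` at rational points ★ `doublingLift_ratSp`).  p07's `doublingLiftMp (s_pair (ξ, 1))` is this by `hs.1` (`proj ∘ s_pair = toSp`).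
[cite: Weil1964, Chap. I n° 13 p. 160 and Chap. III n° 41 Thm 6 p. 193] [cite: GelbartPiatetskishapiroRallis1987, Part A §2 pp. 7–9] -/
def vDiagLift : UnitaryGroup.adelic F E c N (TV.map (algebraMap F E)) →* adelicMpCont F (Fin (n + n)) (doubledGramFin F (adelicGram F e TV TW)) :=
  (doublingLift F (adelicGram F e TV TW) (isUnit_det_adelicGram F e hVd hWd)).comp
    ((toSp F E c N 1 e (TV.map (algebraMap F E)) (TW.map (algebraMap F E)) hcδ hδ hd hV hW rfl rfl).comp
      (UnitaryGroup.adelicInl F E c N 1 (TV.map (algebraMap F E)) (TW.map (algebraMap F E))))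

/-- **the doubled theta integral `I□(Ψ) := ∫_{[U(J_V)]} Θ_{n+n}(ω□(IV□(ξ̃⁻¹)) Ψ) dν(ξ)`** over the compact quotient `[U(J_V)]`, the integrand read at the
representative `ξ̃ = ξ.out` (it is right-`U(J_V)(F)`-invariant by `Θ`-rigidity, ★ `doublingLift_ratSp`) — the theta integral of the doubled pair
`(U(J_V), U(W ⊕ W⁻))` at the identity of `U(W ⊕ W⁻)`; convention `ξ̃⁻¹` as in ★ `thetaKer_mk`. [cite: Weil1965, Thm. 5 (p. 76)] [cite: Li1992, (24) p. 184] -/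
def doubledThetaIntegral
    [MeasurableSpace (UnitaryGroup.adelic F E c N (TV.map (algebraMap F E)) ⧸ (UnitaryGroup.toAdelic F E c N (TV.map (algebraMap F E))).range)]
    (ν : Measure (UnitaryGroup.adelic F E c N (TV.map (algebraMap F E)) ⧸ (UnitaryGroup.toAdelic F E c N (TV.map (algebraMap F E))).range))
    (Ψ : piSchwartzBruhat F (Fin (n + n))) : ℂ :=
  ∫ ξ, thetaDistLM F (Fin (n + n))
      (adelicMpCont.omega F (Fin (n + n)) (doubledGramFin F (adelicGram F e TV TW))
        (vDiagLift F E c hcδ hδ hd N e TV hV hVd TW hW hWd (Quotient.out ξ)⁻¹) Ψ) ∂ν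

end Carriers

/-! ## §2 The Siegel–Eisenstein carrier property and the Eisenstein series on `P(F)\\H(F)` (generic) -/

/-- **POSITED INTERFACE — a Siegel–Eisenstein carrier** for a group `R` acting on a space `S` (here: `R = Sp_{2(n+n)}(F)` acting on
`𝒮(𝔸_F^{n+n})` through `r_F^□`), a subgroup `P ≤ R` (here: the rational stabiliser `PW` of the diagonal Lagrangian) and a functional `ev0` (here:
`Ψ ↦ (ω□(r_Fδ)Ψ)(0)`): the ONE property that makes the Eisenstein sum well defined — `ev0 (p • Ψ) = ev0 Ψ` for `p ∈ P` ([Weil1965, n° 39 (30)]: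
`f_Φ(pg) = f_Φ(g)`; here: `δpδ⁻¹ ∈ P_𝕐(F)`, `𝐫₀ = r_F` on `P_𝕐(F)` ★ `adelicSiegelLiftCont_eq_ratPointsThetaLiftCont_of_mem_range`, product formula
`|det a|_𝔸 = 1`).  A `Prop` with `P`, `ev0` as PARAMETERS (the vacuous pair «`C.P = PW ∧ C.ev0 = ev0`» is not typed); a PROPERTY, asserted nowhere in this
file (it is conjunct (i) of the E-2 child line's `StubSW2`, ★ for `(r_F^□, PW, ev₀)` by `AdelicDoublingOriginValueInvariance`). [cite: Weil1965, n° 39 (30) p. 55 and n° 40 Thm. 1 (p. 57)] -/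
structure SiegelEisensteinCarrier (R : Type*) [Group R] (S : Type*) (act : R → S → S) (P : Subgroup R) (ev0 : S → ℂ) : Prop where
  /-- `f_Ψ(p g) = f_Ψ(g)`: the section is left-`P(F)`-invariant -/
  ev0_act_P : ∀ p ∈ P, ∀ Ψ : S, ev0 (act p Ψ) = ev0 Ψ

section Eisenstein

variable {R : Type*} [Group R] {S : Type*} (act : R → S → S) (H P : Subgroup R) (ev0 : S → ℂ)

/-- **the Siegel–Weil section on `P(F)\\H(F)`**, `f_Ψ(c) := ev0 (c̃⁻¹ • Ψ)` for a representative `c̃ ∈ H` of the LEFT coset `c ∈ H ⧸ (P ⊓ H)` — the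
inversion turns Mathlib's left cosets into print's right cosets `P\\H` on which `g ↦ (ω(g)Ψ)(0)` lives (independence of `c̃` is `ev0_act_P`).
[cite: Weil1965, n° 39 (30) p. 55] -/
def eisSection (Ψ : S) (q : H ⧸ P.subgroupOf H) : ℂ :=
  ev0 (act ((Quotient.out q : H) : R)⁻¹ Ψ)

/-- **the Eisenstein series at `g = 1`**: `E(Ψ) := Σ'_{c ∈ H ⧸ P} f_Ψ(c)` (= [Weil1965, n° 39 (30)] `E(Φ) = Σ_{P(F)\\H(F)} (r(γ)Φ)(0)`; `E(g; f_Ψ) = E(ω(g)Ψ)`).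
[cite: Weil1965, n° 39 (30) p. 55] -/
def eis (Ψ : S) : ℂ := ∑' q : H ⧸ P.subgroupOf H, eisSection act H P ev0 Ψ q

end Eisenstein

/-! ## §3 Action laws of `r_F^□` -/

section ActionLaws

variable (F : Type) [Field F] [NumberField F] (N : ℕ) {n : ℕ} (e : Fin N × Fin 1 ≃ Fin n)
  (TV : Matrix (Fin N) (Fin N) F) (hVd : IsUnit TV.det) (TW : Matrix (Fin 1) (Fin 1) F) (hWd : IsUnit TW.det)

/-- `r_F^□(ab) · Ψ = r_F^□(a) · (r_F^□(b) · Ψ)` (homomorphy of `r_F^□` and of `ω□`). [cite: Weil1964, Chap. III n° 40 p. 190] -/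
theorem actRat_mul (a b : Matrix.symplecticGroup (Fin (n + n)) F) (Ψ : piSchwartzBruhat F (Fin (n + n))) :
    actRat F N e TV hVd TW hWd (a * b) Ψ = actRat F N e TV hVd TW hWd a (actRat F N e TV hVd TW hWd b Ψ) := by
  simp only [actRat, map_mul, Module.End.mul_apply]

/-- `r_F^□(1) · Ψ = Ψ`. [cite: Weil1964, Chap. III n° 40 p. 190] -/
theorem actRat_one (Ψ : piSchwartzBruhat F (Fin (n + n))) : actRat F N e TV hVd TW hWd 1 Ψ = Ψ := by
  simp only [actRat, map_one, Module.End.one_apply]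

/-- `r_F^□(a⁻¹) · (r_F^□(a) · Ψ) = Ψ`. [cite: Weil1964, Chap. III n° 40 p. 190] -/
theorem actRat_inv_actRat (a : Matrix.symplecticGroup (Fin (n + n)) F) (Ψ : piSchwartzBruhat F (Fin (n + n))) :
    actRat F N e TV hVd TW hWd a⁻¹ (actRat F N e TV hVd TW hWd a Ψ) = Ψ := by
  rw [← actRat_mul, inv_mul_cancel, actRat_one]

end ActionLaws

end Literature.NumberTheory.Li1992.DoubledPair

end
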